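import Summits.Ventures.HSemireg.WedgeHankelRecurrenceGaussBessel

/-!
# Venture HSemireg — **THE WEIGHTED CHEBYSHEV (COVARIANCE) INEQUALITY AND THE RAYLEIGH QUOTIENT UNDER A MONOTONE DENSITY**: for weights `a ≥ 0` and two similarly ordered
# sequences `f`, `g`, `(Σ a f)(Σ a g) ≤ (Σ a)(Σ a f g)` (strict as soon as two charged indices are strictly ordered); hence for a discrete measure `ν` on nodes `w` and a density `g`
# that is non-decreasing along `w`, `(Σ gν P²)(Σ ν w P²) ≤ (Σ ν P²)(Σ gν w P²)` for every polynomial `P` — the Rayleigh quotient of multiplication by `x` does not decrease when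
# `ν` is replaced by `gν` — and the barycentre moves to the right

HONEST FRAMING. Part of the Lean index of the computation cell `pub-hsemireg` (seat p10 gen 44, Sunday typer «UNIFORM-IN-n»).  Finite sums of real numbers and real polynomials only; no variety,
no cohomology theory, no sheaf, no Ext group and no semiregularity map is constructed here; nothing here says that HC / HC_CM / HC_AV holds; no Literature fact (unproved `Prop`) is declared or
used.  Custodian versions as in `WedgeHankelSiegelIdeal` (1/3).
SOURCES (cited).  P. L. Chebyshev, *O približennyh vyraženiâh odnih integralov čerez drugie* (1882); G. H. Hardy, J. E. Littlewood, G. Pólya, *Inequalities* (2nd ed. 1952), Thm 43 (§2.17: the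
weighted form `Σp Σpab ≥ Σpa Σpb` for similarly ordered `a`, `b`) and Thm 236; G. Szegő, *Orthogonal Polynomials*, §6.12 (where the monotone density enters A. Markov's theorem — typed in
the next leaf).
PROOF TYPED HERE.  The doubled covariance identity `2[(Σa)(Σafg) − (Σaf)(Σag)] = Σ_i Σ_j a_i a_j (f_i − f_j)(g_i − g_j)`, whose right-hand side is a sum of non-negative (resp. non-positive)
terms for similarly (resp. oppositely) ordered `f`, `g`; strictness from one strictly positive term.  The Rayleigh form is the case `a_l = ν_l P(w_l)²`, `f = g`, second sequence `= w`.
DEDUP DISCLOSURE (`rg -n 'chebyshev_sum|covariance|comonotone|similarly ordered' Summits/Ventures/HSemireg Literature`, `lean search 'sum_mul_sum_le_card_mul_sum'`, 2026-09-03): Mathlib has the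
UNWEIGHTED Chebyshev sum inequality `MonovaryOn.sum_mul_sum_le_card_mul_sum` (factor `#s`); the weighted form with arbitrary non-negative weights is not in Mathlib or the tree
(`Summits/Ventures/PercRepro2/M9HarrisCube.sum_mul_sum_le_card_mul_sum` is again a cardinality form over `ℤ`).  The 9 names below: 0 hits tree-wide.

WHAT IS IN THE TREE.  Mathlib `Finset.sum_nonneg`, `Finset.single_le_sum`; nothing of the chapter is needed for this leaf (it is imported only to keep the chapter linear).
THIS FILE (namespace `Summit.Ventures.HSemireg.Wedge.HankelOuter` continued; CHAINED on N318 (import only); 0 definitions):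
* §1084 `two_mul_covariance_eq_sum_sum` (the doubled covariance identity), **`weighted_chebyshev_sum_le`** (`(Σaf)(Σag) ≤ (Σa)(Σafg)`, similarly ordered), `weighted_chebyshev_sum_ge`
  (oppositely ordered), **`weighted_chebyshev_sum_lt`** (strict), `similarly_ordered_of_monotone_along` ∕ `oppositely_ordered_of_antitone_along` (a sequence monotone ∕ antitone along
  `w` is similarly ∕ oppositely ordered with `w`), **`rayleigh_num_mul_le_of_monotone_density`** (`(Σ gν P²)(Σ ν w P²) ≤ (Σ ν P²)(Σ gν w P²)`), `rayleigh_num_mul_ge_of_antitone_density`,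
  `barycentre_mul_le_of_monotone_density` (`(Σ gν)(Σ ν w) ≤ (Σ ν)(Σ gν w)`).
CAVEATS.  Finite index types; real weights; «monotone along `w`» is the hypothesis `w l < w l' → g l ≤ g l'` (no function on `ℝ` is posited).  Nothing Ext-side.  New names only.
-/

open Module Polynomial
open scoped Matrix Polynomial

namespace Summit.Ventures.HSemireg.Wedge.HankelOuter

/-! ## §1084. The weighted Chebyshev inequality; the Rayleigh quotient under a monotone density -/

/-- **The doubled covariance identity `2[(Σa)(Σafg) − (Σaf)(Σag)] = Σ_i Σ_j a_i a_j (f_i − f_j)(g_i − g_j)`.** [HLP §2.17; this file, §1084] -/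
theorem two_mul_covariance_eq_sum_sum {ι : Type*} [Fintype ι] (a f g : ι → ℝ) :
    2 * ((∑ i, a i) * ∑ i, a i * (f i * g i) - (∑ i, a i * f i) * ∑ i, a i * g i) =
      ∑ i, ∑ j, a i * a j * ((f i - f j) * (g i - g j)) := by
  have h : ∀ i j, a i * a j * ((f i - f j) * (g i - g j)) =
      a i * (f i * g i) * a j + a i * (a j * (f j * g j)) - (a i * f i * (a j * g j) + a i * g i * (a j * f j)) := fun i j => by ring
  simp_rw [h, Finset.sum_sub_distrib, Finset.sum_add_distrib, ← Finset.mul_sum, ← Finset.sum_mul]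
  ring

/-- **WEIGHTED CHEBYSHEV SUM INEQUALITY: `(Σ a f)(Σ a g) ≤ (Σ a)(Σ a f g)`** for weights `a ≥ 0` and similarly ordered `f`, `g` (`(f_i − f_j)(g_i − g_j) ≥ 0`).
[Chebyshev 1882; HLP Thm 43; this file, §1084] -/
theorem weighted_chebyshev_sum_le {ι : Type*} [Fintype ι] {a f g : ι → ℝ} (ha : ∀ i, 0 ≤ a i) (hfg : ∀ i j, 0 ≤ (f i - f j) * (g i - g j)) :
    (∑ i, a i * f i) * ∑ i, a i * g i ≤ (∑ i, a i) * ∑ i, a i * (f i * g i) := by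
  have h2 := two_mul_covariance_eq_sum_sum a f g
  have hnn : 0 ≤ ∑ i, ∑ j, a i * a j * ((f i - f j) * (g i - g j)) :=
    Finset.sum_nonneg fun i _ => Finset.sum_nonneg fun j _ => mul_nonneg (mul_nonneg (ha i) (ha j)) (hfg i j)
  linarith

/-- **Oppositely ordered `f`, `g`: `(Σ a)(Σ a f g) ≤ (Σ a f)(Σ a g)`.** [HLP Thm 43; this file, §1084] -/
theorem weighted_chebyshev_sum_ge {ι : Type*} [Fintype ι] {a f g : ι → ℝ} (ha : ∀ i, 0 ≤ a i) (hfg : ∀ i j, (f i - f j) * (g i - g j) ≤ 0) :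
    (∑ i, a i) * ∑ i, a i * (f i * g i) ≤ (∑ i, a i * f i) * ∑ i, a i * g i := by
  have h2 := two_mul_covariance_eq_sum_sum a f g
  have hnp : ∑ i, ∑ j, a i * a j * ((f i - f j) * (g i - g j)) ≤ 0 :=
    Finset.sum_nonpos fun i _ => Finset.sum_nonpos fun j _ => mul_nonpos_of_nonneg_of_nonpos (mul_nonneg (ha i) (ha j)) (hfg i j)
  linarith

/-- **STRICT WEIGHTED CHEBYSHEV: `(Σ a f)(Σ a g) < (Σ a)(Σ a f g)`** as soon as two indices `i₀`, `j₀` carry positive weights and are strictly ordered, `(f_{i₀} − f_{j₀})(g_{i₀} − g_{j₀}) > 0`.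
[HLP Thm 43 (case of equality); this file, §1084] -/
theorem weighted_chebyshev_sum_lt {ι : Type*} [Fintype ι] {a f g : ι → ℝ} (ha : ∀ i, 0 ≤ a i) (hfg : ∀ i j, 0 ≤ (f i - f j) * (g i - g j))
    {i₀ j₀ : ι} (hi₀ : 0 < a i₀) (hj₀ : 0 < a j₀) (hstrict : 0 < (f i₀ - f j₀) * (g i₀ - g j₀)) :
    (∑ i, a i * f i) * ∑ i, a i * g i < (∑ i, a i) * ∑ i, a i * (f i * g i) := by
  have h2 := two_mul_covariance_eq_sum_sum a f g
  have hterm : 0 < a i₀ * a j₀ * ((f i₀ - f j₀) * (g i₀ - g j₀)) := mul_pos (mul_pos hi₀ hj₀) hstrict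
  have hle1 : a i₀ * a j₀ * ((f i₀ - f j₀) * (g i₀ - g j₀)) ≤ ∑ j, a i₀ * a j * ((f i₀ - f j) * (g i₀ - g j)) :=
    Finset.single_le_sum (f := fun j => a i₀ * a j * ((f i₀ - f j) * (g i₀ - g j))) (fun j _ => mul_nonneg (mul_nonneg (ha i₀) (ha j)) (hfg i₀ j)) (Finset.mem_univ j₀)
  have hle2 : ∑ j, a i₀ * a j * ((f i₀ - f j) * (g i₀ - g j)) ≤ ∑ i, ∑ j, a i * a j * ((f i - f j) * (g i - g j)) :=
    Finset.single_le_sum (f := fun i => ∑ j, a i * a j * ((f i - f j) * (g i - g j)))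
      (fun i _ => Finset.sum_nonneg fun j _ => mul_nonneg (mul_nonneg (ha i) (ha j)) (hfg i j)) (Finset.mem_univ i₀)
  linarith

/-- A sequence `f` that is non-decreasing ALONG `w` (`w_i < w_j ⇒ f_i ≤ f_j`) is similarly ordered with `w`: `(f_i − f_j)(w_i − w_j) ≥ 0`. [this file, §1084] -/
theorem similarly_ordered_of_monotone_along {ι : Type*} {w f : ι → ℝ} (hf : ∀ i j, w i < w j → f i ≤ f j) (i j : ι) : 0 ≤ (f i - f j) * (w i - w j) := by
  rcases lt_trichotomy (w i) (w j) with h | h | h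
  · exact mul_nonneg_of_nonpos_of_nonpos (sub_nonpos.2 (hf i j h)) (sub_nonpos.2 h.le)
  · rw [h, sub_self, mul_zero]
  · exact mul_nonneg (sub_nonneg.2 (hf j i h)) (sub_nonneg.2 h.le)

/-- A sequence `f` that is non-increasing ALONG `w` (`w_i < w_j ⇒ f_j ≤ f_i`) is oppositely ordered with `w`: `(f_i − f_j)(w_i − w_j) ≤ 0`. [this file, §1084] -/
theorem oppositely_ordered_of_antitone_along {ι : Type*} {w f : ι → ℝ} (hf : ∀ i j, w i < w j → f j ≤ f i) (i j : ι) : (f i - f j) * (w i - w j) ≤ 0 := by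
  rcases lt_trichotomy (w i) (w j) with h | h | h
  · exact mul_nonpos_of_nonneg_of_nonpos (sub_nonneg.2 (hf i j h)) (sub_nonpos.2 h.le)
  · rw [h, sub_self, mul_zero]
  · exact mul_nonpos_of_nonpos_of_nonneg (sub_nonpos.2 (hf j i h)) (sub_nonneg.2 h.le)

/-- **THE RAYLEIGH QUOTIENT OF `x` DOES NOT DECREASE UNDER A NON-DECREASING DENSITY: `(Σ_l g_l ν_l P(w_l)²)(Σ_l ν_l w_l P(w_l)²) ≤ (Σ_l ν_l P(w_l)²)(Σ_l g_l ν_l w_l P(w_l)²)`**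
for `ν ≥ 0` and `g` non-decreasing along `w` (weighted Chebyshev with `a_l = ν_l P(w_l)²`). [HLP Thm 43; Szegő §6.12; this file, §1084] -/
theorem rayleigh_num_mul_le_of_monotone_density {N : ℕ} {ν w g : Fin N → ℝ} (hν : ∀ l, 0 ≤ ν l) (hgw : ∀ l l', w l < w l' → g l ≤ g l') (P : ℝ[X]) :
    (∑ l, (g l * ν l) * (P.eval (w l)) ^ 2) * ∑ l, ν l * (w l * (P.eval (w l)) ^ 2) ≤
      (∑ l, ν l * (P.eval (w l)) ^ 2) * ∑ l, (g l * ν l) * (w l * (P.eval (w l)) ^ 2) := by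
  have h := weighted_chebyshev_sum_le (a := fun l => ν l * (P.eval (w l)) ^ 2) (f := g) (g := w) (fun l => mul_nonneg (hν l) (sq_nonneg _))
    (similarly_ordered_of_monotone_along hgw)
  have e1 : ∑ l, (g l * ν l) * (P.eval (w l)) ^ 2 = ∑ l, ν l * (P.eval (w l)) ^ 2 * g l := Finset.sum_congr rfl fun l _ => by ring
  have e2 : ∑ l, ν l * (w l * (P.eval (w l)) ^ 2) = ∑ l, ν l * (P.eval (w l)) ^ 2 * w l := Finset.sum_congr rfl fun l _ => by ring
  have e3 : ∑ l, (g l * ν l) * (w l * (P.eval (w l)) ^ 2) = ∑ l, ν l * (P.eval (w l)) ^ 2 * (g l * w l) := Finset.sum_congr rfl fun l _ => by ring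
  rw [e1, e2, e3]
  exact h

/-- **A NON-INCREASING DENSITY REVERSES IT: `(Σ ν P²)(Σ gν w P²) ≤ (Σ gν P²)(Σ ν w P²)`** for `ν ≥ 0` and `g` non-increasing along `w`. [HLP Thm 43; this file, §1084] -/
theorem rayleigh_num_mul_ge_of_antitone_density {N : ℕ} {ν w g : Fin N → ℝ} (hν : ∀ l, 0 ≤ ν l) (hgw : ∀ l l', w l < w l' → g l' ≤ g l) (P : ℝ[X]) :
    (∑ l, ν l * (P.eval (w l)) ^ 2) * ∑ l, (g l * ν l) * (w l * (P.eval (w l)) ^ 2) ≤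
      (∑ l, (g l * ν l) * (P.eval (w l)) ^ 2) * ∑ l, ν l * (w l * (P.eval (w l)) ^ 2) := by
  have h := weighted_chebyshev_sum_ge (a := fun l => ν l * (P.eval (w l)) ^ 2) (f := g) (g := w) (fun l => mul_nonneg (hν l) (sq_nonneg _))
    (oppositely_ordered_of_antitone_along hgw)
  have e1 : ∑ l, (g l * ν l) * (P.eval (w l)) ^ 2 = ∑ l, ν l * (P.eval (w l)) ^ 2 * g l := Finset.sum_congr rfl fun l _ => by ring
  have e2 : ∑ l, ν l * (w l * (P.eval (w l)) ^ 2) = ∑ l, ν l * (P.eval (w l)) ^ 2 * w l := Finset.sum_congr rfl fun l _ => by ring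
  have e3 : ∑ l, (g l * ν l) * (w l * (P.eval (w l)) ^ 2) = ∑ l, ν l * (P.eval (w l)) ^ 2 * (g l * w l) := Finset.sum_congr rfl fun l _ => by ring
  rw [e1, e2, e3]
  exact h

/-- **THE BARYCENTRE MOVES RIGHT UNDER A NON-DECREASING DENSITY: `(Σ gν)(Σ ν w) ≤ (Σ ν)(Σ gν w)`** (`ν ≥ 0`; the case `P = 1`). [HLP Thm 43; this file, §1084] -/
theorem barycentre_mul_le_of_monotone_density {N : ℕ} {ν w g : Fin N → ℝ} (hν : ∀ l, 0 ≤ ν l) (hgw : ∀ l l', w l < w l' → g l ≤ g l') :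
    (∑ l, g l * ν l) * ∑ l, ν l * w l ≤ (∑ l, ν l) * ∑ l, (g l * ν l) * w l := by
  have h := rayleigh_num_mul_le_of_monotone_density hν hgw (1 : ℝ[X])
  simpa only [eval_one, one_pow, mul_one] using h

end Summit.Ventures.HSemireg.Wedge.HankelOuter
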